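import Mathlib
import Literature.Computability.Cryptography.WordRAMProofs
import Literature.Computability.MetaComplexity.ChenJinWilliams2019.UniformAdviceRAM
import Literature.Computability.MetaComplexity.ChenJinSanthanamWilliams2022.OneTapeRefuterMagnification
import HarnessLib

/-!
# Chen–Jin–Santhanam–Williams (FOCS 2021), Theorem 1.5 `theo:general` — the GENERAL form of the
# one-tape refuter magnification theorem (row R66), over nondeterministic word-RAM time
# (device D16e `NTIMERAM`); the printed instance `L = PAL` is `OneTapeRefuterMagnification.lean`

Source: L. Chen, C. Jin, R. Santhanam, R. Williams, *Constructive separations and their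
consequences*, FOCS 2021 / TheoretiCS 2024 (bib key `ChenEtAl2022`; held text
`paper:arxiv-2203.14379`, locators `pNNNN Lk` refer to it).

## What print says (verbatim)

* **Theorem 1.5 `theo:general` (p0005 L29), the typed statement:** *"For every language L
  computable by a nondeterministic n^{1+o(1)}-time RAM, a P^NP-constructive separation of L from
  nondeterministic O(n^{1.1})-time one-tape Turing machines implies E^NP ⊄ SIZE[2^{δn}] for some
  constant δ > 0."*
* Its proof (§3.3, p0014 L20–34) uses the RAM premise only through Lemma 5 `lemma:red`
  (p0014 L22–23, citing [Tourlakis01, FortnowLMV05]): *"Let M be a T(n)-time nondeterministic RAM.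
  There exists a strongly explicit family of 3-SAT formulas {C_n}_{n ∈ ℕ} of T · polylog(T) size,
  such that for every x ∈ {0,1}ⁿ, M(x) = 1 if and only if there exists y such that C_n(x,y) = 1."*
  and then (p0014 L29–30): *"Let M_RAM be a nondeterministic n^{1+o(1)}-time RAM for L. We apply
  Lemma (lemma:red) to obtain a strongly explicit family of 3-SAT formulas {C_n} with n^{1+o(1)}
  size and s = n^{1+o(1)} variables."* Print does not fix a RAM model; the cited reduction is
  robust: [Fortnow–Lipton–van Melkebeek–Viglas 2005, §2 p. 4 L5–6] *"Up to polylogarithmic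
  factors, our results are robust with respect to the choice of random-access machine model."*
* The `PAL` instance, §3.3 Theorem `thm:pal` bullet 1 (p0014 L6), is the landed named fact
  `thmPal_PNP` of `OneTapeRefuterMagnification.lean` (whose module docstring records that the
  general form was left untyped for want of a random-access machine class; the tree has since
  acquired the deterministic word-RAM classes D16 `DTIMERAM`/`DTIMEADV`/`DTISPADV` of
  `ChenJinWilliams2019/UniformAdviceRAM.lean`, which this file extends by nondeterminism).

## Rendering (rule F2: the typed statement is WEAKER than or equal to print)

* **D16e, nondeterministic word-RAM time (`NTIMERAM t`).** The machine is the tree's unit-cost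
  word RAM (`Cryptography/WordRAM`: `Program`, `step`, `OutputsWithin`, `HaltsWithin`; input
  convention `advInput x []` / word size `advWordSize k x []` of D16, i.e. NO advice), and the
  nondeterministic GUESSES are the words delivered by the `rand` instruction from the stream
  `ρ : ℕ → ℕ` (the `coinPos`-th guess word, reduced mod `2^w`) — the standard identification of a
  nondeterministic machine with a deterministic machine reading a guess string [Arora–Barak 2009,
  §2.1.2 / Def. 2.1 (NDTM; certificate definition of NP, Thm. 2.6)]. `L ∈ NTIMERAM t` iff for some
  oracle-free program `P` and constants `k, c`: on every input `x` of length `n`, (i) under EVERY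
  guess stream the run halts within `c·t(n) + c` steps (all computation paths bounded — the
  all-paths time convention already used for D15 `NTM1`, Arora–Barak §2.1.2), and (ii) `x ∈ L` iff
  SOME guess stream makes the run output `[1]` within `c·t(n) + c` steps. "Computable by a
  nondeterministic `n^{1+o(1)}`-time RAM" is membership in `NTIMERAMAlmostLinear`
  `= ⋃ {NTIMERAM t : ∀ ε > 0, t(n) ≤ n^{1+ε} eventually}`.
  DIRECTION: a word-RAM program with `O(log n)`-bit words running in time `t` under every guess
  stream is a nondeterministic random-access machine of time `t · polylog(t + n)` in any of the
  standard models (each unit-cost word operation is a polylogarithmic-time subroutine; guessing a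
  word is `O(log n)` guessed bits) — the folklore simulation behind the robustness remark of
  [FortnowEtAl2005, §2 p. 4] quoted above — and `n^{1+o(1)} · polylog(n) = n^{1+o(1)}`. Hence
  `NTIMERAMAlmostLinear` is CONTAINED in print's class of languages "computable by a
  nondeterministic `n^{1+o(1)}`-time RAM"; quantifying over FEWER languages `L`, the typed theorem
  `thm15_general` is WEAKER than print. The hypothesis (refuters against every `NTM1` with all paths
  bounded by `c⌊n^{1.1}⌋ + c`) and the conclusion (`IOExpHard EXPNPPoly`) are rendered EXACTLY as in
  the landed `PAL` instance `thmPal_PNP` (direction arguments (D15), (Refuters), (Conclusions) of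
  that file's module docstring apply verbatim with `PAL` replaced by `L`).
* Remark 2 (p0014 L46–48, nondeterministic STREAMING algorithms in place of one-tape machines) and
  bullets 2–3 of the general form are not typed here (print states the general form for `P^NP`
  refuters only: p0014 L44–45 *"We only state the generalization of Theorem (thm:general) below."*).

## Proved here (rule F1, non-vacuity) and HONEST FRAMING

`DTIMERAM t ⊆ NTIMERAM t` (a deterministic program ignores the guess stream:
`WordRAMProofs.haltsWithin_iff_of_isDeterministic`, `outputsWithin_iff_of_isDeterministic_holds`,
`outputsWithin_unique_holds`), hence `0 ∈ NTIMERAM t`; the GUESSING program `guessOne` (write the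
first guess word as the answer bit) accepts EVERY input nondeterministically although its zero-guess
run answers `0` — so `⊤ ∈ NTIMERAM t` by a genuinely nondeterministic witness and the acceptance
clause (ii) is not the deterministic one; `0, ⊤ ∈ NTIMERAMAlmostLinear`. The instance relation is
made explicit: `thm15_general → PAL ∈ NTIMERAMAlmostLinear → thmPal_PNP` (`thmPal_PNP_of_general`);
the membership `PAL ∈ NTIMERAMAlmostLinear` (a linear-time palindrome test on the word RAM) is
routine but NOT proved here, so the landed `thmPal_PNP` remains the census's typed threshold for
R66 and `thm15_general` is its typed generalisation. Typed, NOT proved: `thm15_general`. Nothing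
here is an approach to the summit.
-/

noncomputable section

namespace Literature.Computability.MetaComplexity.ChenJinSanthanamWilliams2022

open Filter
open Literature.Computability.Cryptography.WordRAM StateTransition
open Literature.Computability.Complexity Literature.Computability.Complexity.Nondeterministic
open Literature.Computability.MetaComplexity.ChenJinWilliams2019

/-! ### D16e — nondeterministic time on the word RAM (guess stream = coin stream) -/

/-- `NHaltsAllWithin P k x T`: on input `x` (no advice; word size `advWordSize k x []`, no oracle),
under EVERY guess stream `ρ` the run of `P` halts within `T` steps ("all computation paths have
length at most `T`"). [cite: AroraBarak2009, §2.1.2 (time of a nondeterministic machine: every sequence of choices halts within T(|x|) steps)] -/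
def NHaltsAllWithin (P : Program) (k : ℕ) (x : List Bool) (T : ℕ) : Prop :=
  ∀ ρ : ℕ → ℕ, ∃ c : Cfg, HaltsWithin P (advWordSize k x []) noOracle ρ (advInput x []) T c

/-- `NAcceptsWithin P k x T`: SOME guess stream `ρ` makes the run of `P` on `x` output `[1]` within
`T` steps ("some computation path accepts"). [cite: AroraBarak2009, §2.1.2 / Thm. 2.6 (nondeterministic acceptance = some sequence of choices / some certificate accepts)] -/
def NAcceptsWithin (P : Program) (k : ℕ) (x : List Bool) (T : ℕ) : Prop :=
  ∃ ρ : ℕ → ℕ, OutputsWithin P (advWordSize k x []) noOracle ρ (advInput x []) [1] T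

/-- **D16e. `NTIMERAM t`** — languages accepted by a NONDETERMINISTIC oracle-free word-RAM program
in time `c·t(n) + c`: the guesses are the words read by `rand` from the stream `ρ`; all guess
streams halt within the bound, and `x ∈ L` iff some guess stream yields output `[1]` within the
bound. Print (Thm. 1.5 / Lemma 5): *"a T(n)-time nondeterministic RAM"*; rendering and direction
(word RAM ⊆ print's RAMs up to polylog factors): module docstring (D16e).
[cite: ChenEtAl2022, Thm. 1.5 (theo:general) p.5 L29 and Lemma 5 (lemma:red) p.14 L22 ("T(n)-time nondeterministic RAM")] -/
def NTIMERAM (t : ℕ → ℕ) : Set (Language Bool) :=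
  {L | ∃ (P : Program) (k c : ℕ), P.IsOracleFree ∧
      ∀ x : List Bool, NHaltsAllWithin P k x (c * t x.length + c) ∧
        (x ∈ L ↔ NAcceptsWithin P k x (c * t x.length + c))}

/-- `IsAlmostLinear t` — "`t(n) = n^{1+o(1)}`": for every real `ε > 0`, `t(n) ≤ n^{1+ε}` for all
large `n`. [cite: ChenEtAl2022, Thm. 1.5 ("nondeterministic n^{1+o(1)}-time RAM"), p.5 L29] -/
def IsAlmostLinear (t : ℕ → ℕ) : Prop :=
  ∀ ε : ℝ, 0 < ε → ∀ᶠ n : ℕ in atTop, (t n : ℝ) ≤ (n : ℝ) ^ (1 + ε)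

/-- **"computable by a nondeterministic `n^{1+o(1)}`-time RAM"** (word-RAM rendering, D16e):
`L ∈ NTIMERAM t` for some almost-linear `t`. [cite: ChenEtAl2022, Thm. 1.5 (theo:general), p.5 L29] -/
def NTIMERAMAlmostLinear : Set (Language Bool) :=
  {L | ∃ t : ℕ → ℕ, IsAlmostLinear t ∧ L ∈ NTIMERAM t}

/-! ### The typed theorem (general form, `P^NP` refuters) -/

/-- **[CJSW21, Theorem 1.5 `theo:general`]** (typed WEAKER than print, module docstring): for every
language `L` accepted by a nondeterministic word-RAM program in almost-linear time, if for EVERY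
nondeterministic single-tape machine `M` and every constant `c` with all computation paths bounded
by `c⌊n^{1.1}⌋ + c` there is a `P^NP` refuter for `L` against `M`, then `EXP^NP` (D14′
`EXPNPPoly ⊇ E^NP`) contains a language of circuit complexity `> 2^{δn}` infinitely often, for some
`δ > 0`. Verbatim (p0005 L29): "For every language L computable by a nondeterministic
n^{1+o(1)}-time RAM, a P^NP-constructive separation of L from nondeterministic O(n^{1.1})-time
one-tape Turing machines implies E^NP ⊄ SIZE[2^{δn}] for some constant δ > 0." Typed, NOT proved.
[cite: ChenEtAl2022, Thm. 1.5 (theo:general), p.5 L29; proof §3.3 p.14 L20–34] -/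
def thm15_general : Prop :=
  ∀ L : Language Bool, L ∈ NTIMERAMAlmostLinear →
    (∀ M : NTM1, ∀ c : ℕ, M.IsTimeBounded (palTime c) → HasPNPRefuter L M.lang) →
      IOExpHard EXPNPPoly

/-- **The printed instance relation, made explicit:** the general form yields the `PAL` instance
`thmPal_PNP` (§3.3 Theorem `thm:pal`, bullet 1) as soon as `PAL` is accepted by a nondeterministic
word RAM in almost-linear time (routine — a deterministic linear-time palindrome test — but not
proved in the tree). [cite: ChenEtAl2022, §3.3 p.14 L25 ("Now we are ready to generalize Theorem (thm:pal) to other problems.")] -/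
theorem thmPal_PNP_of_general (h : thm15_general) (hPAL : PAL ∈ NTIMERAMAlmostLinear) :
    thmPal_PNP :=
  fun href => h PAL hPAL href

/-! ### Structure of D16e: monotonicity, determinism is a special case -/

/-- Monotonicity of `NHaltsAllWithin` in the time bound. [folklore] -/
theorem NHaltsAllWithin.mono {P : Program} {k : ℕ} {x : List Bool} {T T' : ℕ}
    (h : NHaltsAllWithin P k x T) (hT : T ≤ T') : NHaltsAllWithin P k x T' :=
  fun ρ => (h ρ).imp fun _ hc => hc.mono hT

/-- Under the all-paths halting clause, acceptance within a bound is acceptance within any larger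
bound (the halting configuration of a run is unique). [folklore] -/
theorem nacceptsWithin_iff_of_nhaltsAllWithin {P : Program} {k : ℕ} {x : List Bool} {T T' : ℕ}
    (h : NHaltsAllWithin P k x T) (hT : T ≤ T') :
    NAcceptsWithin P k x T' ↔ NAcceptsWithin P k x T := by
  refine ⟨fun ⟨ρ, hρ⟩ => ?_, fun ⟨ρ, hρ⟩ => ⟨ρ, hρ.mono hT⟩⟩
  obtain ⟨c, hc⟩ := h ρ
  obtain ⟨c', hc', hout⟩ := (outputsWithin_iff_exists_haltsWithin _ _ _ _ _ _ _).1 hρ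
  have hcc : c = c' := haltsWithin_unique_holds hc hc'
  exact ⟨ρ, (outputsWithin_iff_exists_haltsWithin _ _ _ _ _ _ _).2 ⟨c, hc, hcc ▸ hout⟩⟩

/-- Monotonicity of `NTIMERAM` in the time bound. [folklore] -/
theorem NTIMERAM_mono {t t' : ℕ → ℕ} (ht : ∀ n, t n ≤ t' n) : NTIMERAM t ⊆ NTIMERAM t' := by
  rintro L ⟨P, k, c, ho, h⟩
  refine ⟨P, k, c, ho, fun x => ?_⟩
  obtain ⟨hh, ha⟩ := h x
  have hle : c * t x.length + c ≤ c * t' x.length + c :=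
    Nat.add_le_add_right (Nat.mul_le_mul_left c (ht _)) c
  exact ⟨hh.mono hle, ha.trans (nacceptsWithin_iff_of_nhaltsAllWithin hh hle).symm⟩

/-- **A deterministic decider is a nondeterministic acceptor of the same language within the same
bound:** its runs ignore the guess stream, so every stream halts when the zero stream does, and some
stream outputs `[1]` iff the zero stream does iff (output uniqueness) the decided bit is `1`.
[folklore] -/
theorem nondeterministic_of_decidesAdvWithin {P : Program} (hd : P.IsDeterministic) {k : ℕ}
    {L : Language Bool} {x : List Bool} {T : ℕ}
    (h : DecidesAdvWithin P k (fun _ => []) L x T) :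
    NHaltsAllWithin P k x T ∧ (x ∈ L ↔ NAcceptsWithin P k x T) := by
  obtain ⟨b, hb, hans⟩ := h
  have hans' : OutputsWithin P (advWordSize k x []) noOracle zeroCoins (advInput x []) [b.toNat] T :=
    hans
  refine ⟨fun ρ => ?_, ?_⟩
  · obtain ⟨c, hc, -⟩ := (outputsWithin_iff_exists_haltsWithin _ _ _ _ _ _ _).1 hans'
    exact ⟨c, (haltsWithin_iff_of_isDeterministic hd _ _ ρ zeroCoins _ _ c).2 hc⟩
  · rw [hb]
    constructor
    · rintro rfl
      exact ⟨zeroCoins, hans'⟩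
    · rintro ⟨ρ, hρ⟩
      have h1 : OutputsWithin P (advWordSize k x []) noOracle zeroCoins (advInput x []) [1] T :=
        (outputsWithin_iff_of_isDeterministic_holds hd _ _ ρ zeroCoins _ _ _).1 hρ
      have heq : [b.toNat] = [1] := outputsWithin_unique_holds hans' h1
      cases b
      · simp at heq
      · rfl

/-- **`DTIMERAM t ⊆ NTIMERAM t`** (determinism is the guess-free special case). [folklore] -/
theorem DTIMERAM_subset_NTIMERAM (t : ℕ → ℕ) : DTIMERAM t ⊆ NTIMERAM t := by
  rintro L ⟨P, k, c, hd, ho, h⟩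
  exact ⟨P, k, c, ho, fun x => nondeterministic_of_decidesAdvWithin hd (h x)⟩

/-- **Non-vacuity.** The empty language is in `NTIMERAM t` for every bound. [folklore] -/
theorem zero_mem_NTIMERAM (t : ℕ → ℕ) : (0 : Language Bool) ∈ NTIMERAM t :=
  DTIMERAM_subset_NTIMERAM t (zero_mem_DTIMERAM t)

/-! ### A genuinely nondeterministic witness: `guessOne` -/

/-- `guessOne`: write `1` into cell `0` (output length), write the first GUESS word into cell `1`
(the answer), halt. Its output on any input is `[ρ 0 mod 2^w]`. [folklore] -/
def guessOne : Program :=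
  [.op .lt (.dir 0) (.imm 0) (.imm 1), .rand (.dir 1), .halt]

/-- `guessOne` has no `query`. [folklore] -/
theorem guessOne_isOracleFree : guessOne.IsOracleFree := by decide

/-- `guessOne` is NOT deterministic (it reads a guess word). [folklore] -/
theorem guessOne_not_isDeterministic : ¬ guessOne.IsDeterministic := by decide

/-- **Semantics of `guessOne`**: from any configuration at `pc = 0` it halts after exactly `3`
steps with cells `0 ↦ 1`, `1 ↦ ρ(coinPos) mod 2^w`, one guess word consumed. [folklore] -/
theorem guessOne_run (w : ℕ) (O : List ℕ → List ℕ) (ρ : ℕ → ℕ) (c₀ : Cfg) (h₀ : c₀.pc = some 0) :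
    run guessOne w O ρ 3 c₀ =
      some { c₀ with pc := none,
                     mem := Function.update (Function.update c₀.mem 0 1) 1 (ρ c₀.coinPos % 2 ^ w),
                     coinPos := c₀.coinPos + 1 } := by
  have h1 : step guessOne w O ρ c₀ =
      some { c₀ with pc := some 1, mem := Function.update c₀.mem 0 1 } := by
    rw [step_op (i := 0) h₀ (by rfl)]
    simp [Operand.read, Operand.write, BinOp.eval]
  have h2 : step guessOne w O ρ { c₀ with pc := some 1, mem := Function.update c₀.mem 0 1 } =
      some { c₀ with pc := some 2,
                     mem := Function.update (Function.update c₀.mem 0 1) 1 (ρ c₀.coinPos % 2 ^ w),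
                     coinPos := c₀.coinPos + 1 } := by
    rw [step_rand (i := 1) rfl (by rfl)]
    simp [Operand.write]
  have h3 : step guessOne w O ρ
      { c₀ with pc := some 2,
                mem := Function.update (Function.update c₀.mem 0 1) 1 (ρ c₀.coinPos % 2 ^ w),
                coinPos := c₀.coinPos + 1 } =
      some { c₀ with pc := none,
                     mem := Function.update (Function.update c₀.mem 0 1) 1 (ρ c₀.coinPos % 2 ^ w),
                     coinPos := c₀.coinPos + 1 } :=
    step_halt (i := 2) rfl (by rfl)
  rw [run_succ_of_step _ _ _ _ h1, run_succ_of_step _ _ _ _ h2, run_one, h3]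

/-- `guessOne` outputs `[ρ 0 mod 2^w]` within `T ≥ 3` steps under the guess stream `ρ`. [folklore] -/
theorem guessOne_outputs (w : ℕ) (ρ : ℕ → ℕ) (inp : List ℕ) {T : ℕ} (hT : 3 ≤ T) :
    OutputsWithin guessOne w noOracle ρ inp [ρ 0 % 2 ^ w] T := by
  have hrun := guessOne_run w noOracle ρ (init w inp) (init_pc _ _)
  have hout := outputsWithin_of_run hrun (step_of_pc_eq_none rfl) hT
  have hread : readOut (Function.update (Function.update (init w inp).mem 0 1) 1
      (ρ 0 % 2 ^ w)) = [ρ 0 % 2 ^ w] := by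
    simp [readOut, readSeg]
  simp only [init_coinPos] at hout
  rw [hread] at hout
  exact hout

/-- `guessOne` halts within `T ≥ 3` steps under every guess stream. [folklore] -/
theorem guessOne_nhaltsAllWithin (k : ℕ) (x : List Bool) {T : ℕ} (hT : 3 ≤ T) :
    NHaltsAllWithin guessOne k x T := fun ρ =>
  ((outputsWithin_iff_exists_haltsWithin _ _ _ _ _ _ _).1 (guessOne_outputs _ ρ _ hT)).imp
    fun _ h => h.1

/-- The word size of a run with `k ≥ 1` is positive, so the word `1` is representable. [folklore] -/
theorem one_mod_two_pow_advWordSize {k : ℕ} (hk : 1 ≤ k) (x α : List Bool) :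
    1 % 2 ^ advWordSize k x α = 1 := by
  apply Nat.mod_eq_of_lt
  have hw : 0 < advWordSize k x α :=
    Nat.mul_pos (by omega) (inputWidth_pos _)
  exact Nat.one_lt_two_pow (by omega)

/-- **`guessOne` accepts every input nondeterministically** (guess the word `1`), for `k ≥ 1` and
`T ≥ 3`. [folklore] -/
theorem guessOne_naccepts {k : ℕ} (hk : 1 ≤ k) (x : List Bool) {T : ℕ} (hT : 3 ≤ T) :
    NAcceptsWithin guessOne k x T := by
  refine ⟨fun _ => 1, ?_⟩
  simpa [one_mod_two_pow_advWordSize hk] using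
    guessOne_outputs (advWordSize k x []) (fun _ => 1) (advInput x []) hT

/-- **… although its zero-guess run answers `0`:** under `zeroCoins`, `guessOne` outputs `[0]` and
therefore NOT `[1]` within any bound — the acceptance clause of `NTIMERAM` genuinely quantifies
over guess streams. [folklore] -/
theorem guessOne_zeroCoins_rejects (k : ℕ) (x : List Bool) (T : ℕ) :
    ¬ OutputsWithin guessOne (advWordSize k x []) noOracle zeroCoins (advInput x []) [1] T := by
  intro h
  have h0 : OutputsWithin guessOne (advWordSize k x []) noOracle zeroCoins (advInput x []) [0]
      (max T 3) := by
    simpa [zeroCoins] using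
      guessOne_outputs (advWordSize k x []) zeroCoins (advInput x []) (le_max_right T 3)
  have heq : [1] = [0] := outputsWithin_unique_holds (h.mono (le_max_left T 3)) h0
  simp at heq

/-- **Non-vacuity by a nondeterministic program.** The full language is in `NTIMERAM t` for every
bound (program `guessOne`, `k = 1`, `c = 3`). [folklore] -/
theorem top_mem_NTIMERAM (t : ℕ → ℕ) : (⊤ : Language Bool) ∈ NTIMERAM t := by
  refine ⟨guessOne, 1, 3, guessOne_isOracleFree, fun x => ⟨?_, ?_⟩⟩
  · exact guessOne_nhaltsAllWithin 1 x (by omega)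
  · exact ⟨fun _ => guessOne_naccepts le_rfl x (by omega), fun _ => trivial⟩

/-- The identity bound is almost linear. [folklore] -/
theorem isAlmostLinear_id : IsAlmostLinear fun n => n := by
  intro ε hε
  filter_upwards [eventually_ge_atTop 1] with n hn
  have hn' : (1 : ℝ) ≤ (n : ℝ) := by exact_mod_cast hn
  calc ((n : ℕ) : ℝ) = (n : ℝ) ^ (1 : ℝ) := (Real.rpow_one _).symm
    _ ≤ (n : ℝ) ^ (1 + ε) := Real.rpow_le_rpow_of_exponent_le hn' (by linarith)

/-- **Non-vacuity of the hypothesis class of Theorem 1.5:** `0 ∈ NTIMERAMAlmostLinear`. [folklore] -/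
theorem zero_mem_NTIMERAMAlmostLinear : (0 : Language Bool) ∈ NTIMERAMAlmostLinear :=
  ⟨fun n => n, isAlmostLinear_id, zero_mem_NTIMERAM _⟩

/-- **Non-vacuity of the hypothesis class of Theorem 1.5:** `⊤ ∈ NTIMERAMAlmostLinear`. [folklore] -/
theorem top_mem_NTIMERAMAlmostLinear : (⊤ : Language Bool) ∈ NTIMERAMAlmostLinear :=
  ⟨fun n => n, isAlmostLinear_id, top_mem_NTIMERAM _⟩

/-- `DTIMERAM t ⊆ NTIMERAMAlmostLinear` for almost-linear `t`. [folklore] -/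
theorem DTIMERAM_subset_NTIMERAMAlmostLinear {t : ℕ → ℕ} (ht : IsAlmostLinear t) :
    DTIMERAM t ⊆ NTIMERAMAlmostLinear :=
  fun _ hL => ⟨t, ht, DTIMERAM_subset_NTIMERAM t hL⟩

/-- **F1 (the refuter schema of Theorem 1.5 is not automatic on its hypothesis class):** the
language `⊤ ∈ NTIMERAMAlmostLinear` admits NO refuter schema against the time-bounded `NTM1`s (the
machine `idle true` accepts exactly `⊤`), so `thm15_general` is not vacuously applicable to every
member of its hypothesis class. [folklore] -/
theorem not_refuters_top :
    ¬ ∀ M : NTM1, ∀ c : ℕ, M.IsTimeBounded (palTime c) →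
      HasPNPRefuter ((Set.univ : Set (List Bool)) : Language Bool) M.lang :=
  not_forall_hasRefuterIn_univ _

end Literature.Computability.MetaComplexity.ChenJinSanthanamWilliams2022

end
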